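import Literature.ModelTheory.ExponentialFields.Wilkie1989Lemma3
import HarnessLib

/-!
# Wilkie 1989, §5: Khovanskii's finiteness theorem (named fact) and the bound on isolated zeros

Trunk `TranscendEllArithS`, family `periods` (periods.S28): towards the leaf
`Literature.ModelTheory.ExponentialFields.Wilkie1989_expAlgebraicPoints_mem` (`Wilkie1989.lean`; §§5–6 of A. J. Wilkie, *On the theory
of the real exponential field*, Illinois J. Math. 33 (1989)) of the decomposition of the named
fact `Literature.ModelTheory.ExponentialFields.wilkie_isModelComplete`.

Wilkie's Lemmas 4 and 6 (proved over `ℝ` in `Wilkie1989Curves.lean`) "are not immediately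
transferable to an arbitrary model of `T` (in the case that `g₁, …, gₙ₋₁, g` are terms) because of
the connectedness hypothesis. However, all is well because of the following result of
Khovanskii [3]" (p. 402):

> PROPOSITION. Let `m, n ∈ ℕ`, `n ≥ 2`, `ȳ = (y₁, …, yₘ)`, `x̄ = (x₁, …, xₙ)` and suppose
> `f₁(ȳ, x̄), …, fₚ(ȳ, x̄)` are terms of `L`. Then there is `N ∈ ℕ` such that for any `β̄ ∈ ℝᵐ` the
> subset `Vⁿˢ(f₁(β̄, ·), …, fₚ(β̄, ·))` of `ℝⁿ` has at most `N` connected components (and hence at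
> most `N` points if `p = n`).

This is Khovanskii's theorem on fewnomials and Pfaffian manifolds (Proc. ICM 1983), an external
deep result: it is vendored as the **named fact** `Literature.ModelTheory.ExponentialFields.Wilkie1989_khovanskiiProposition` (the
number of connected components of the real non-singular zero set, uniformly in the parameters).
From it we **prove** the parenthetical consequence "(and hence at most `N` points if `p = n`)"
(`Wilkie1989_khovanskiiProposition.exists_encard_le`: non-singular zeros of a square system are
isolated, by the inverse function theorem, so the connected components are points), and its
**transfer to every model `K` of `T_exp`** (`Wilkie1989_khovanskiiProposition.exists_encard_nonsingularZeroSet_le`),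
which is the form used on p. 406 ("by the proposition of Section 5 … there are exactly `r` points
in `V ∩ ({α₁} × U_B)`").  For the transfer we introduce the first-order counting formulas
"at most `N` solutions" and "exactly `r` solutions" (`atMostF`, `exactCardF`) with their
realization lemmas in any lawful structure; they are reused for Lemmas 4 and 6.

## Mathlib search

Mathlib has `Set.encard`, `connectedComponentIn`, the inverse function theorem
(`HasStrictFDerivAt.eventually_left_inverse`) and finite conjunctions/disjunctions and iterated
quantifiers of first-order formulas (`Formula.iInf`, `Formula.iSup`, `Formula.iExs`); it has no
Pfaffian functions and no Khovanskii-type finiteness theorem.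

## References

* A. J. Wilkie, *On the theory of the real exponential field*, Illinois J. Math. 33 (1989),
  384–408: §5, Proposition (p. 402) and p. 403, p. 406.
* A. G. Khovanskii, *Fewnomials and Pfaff manifolds*, Proc. ICM Warsaw 1983, vol. 1, 549–564
  (PWN, 1984).
-/

noncomputable section

open FirstOrder FirstOrder.Language FirstOrder.Language.Structure
open Topology Filter Set

namespace Literature.ModelTheory.ExponentialFields

namespace RealExpModel

/-! ### Counting solutions in first-order logic -/

section Count

/-- A set has at most `N` elements iff it admits no injective `(N+1)`-tuple. [folklore] -/
theorem encard_le_coe_iff_forall_not_injective {X : Type*} {S : Set X} {N : ℕ} :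
    S.encard ≤ N ↔ ∀ f : Fin (N + 1) → X, (∀ i, f i ∈ S) → ¬ Function.Injective f := by
  constructor
  · intro h f hf hinj
    have h1 : (Set.range f).encard = (N + 1 : ℕ) := by
      rw [← Set.image_univ, hinj.encard_image, Set.encard_univ]
      simp
    have h2 : Set.range f ⊆ S := by rintro _ ⟨i, rfl⟩; exact hf i
    have h3 := (Set.encard_le_encard h2).trans h
    rw [h1, Nat.cast_le] at h3
    omega
  · intro h
    by_contra hlt
    rw [not_le] at hlt
    have hle : ((N + 1 : ℕ) : ℕ∞) ≤ S.encard := by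
      rw [Nat.cast_add_one]
      exact Order.add_one_le_of_lt hlt
    obtain ⟨t, htS, ht⟩ := Set.exists_subset_encard_eq hle
    have htfin : t.Finite := Set.finite_of_encard_le_coe ht.le
    haveI := htfin.to_subtype
    have hcard : Nat.card t = N + 1 := by
      have h1 := htfin.encard_eq_coe_toFinset_card
      rw [ht, Nat.cast_inj] at h1
      rw [Nat.card_coe_set_eq, Set.ncard_eq_toFinset_card t htfin]
      exact h1.symm
    let e := (Finite.equivFinOfCardEq hcard).symm
    exact h (fun i => (e i : X)) (fun i => htS (e i).2)
      (fun i j hij => e.injective (Subtype.ext hij))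

variable {α : Type} {n : ℕ}

/-- **"There are at most `N` tuples `x̄` with `φ(v̄, x̄)`"** as a first-order formula in the
variables `v̄`: there are no `N + 1` pairwise distinct solutions. [folklore] -/
def atMostF (φ : Language.orderedExpRing.Formula (α ⊕ Fin n)) (N : ℕ) :
    Language.orderedExpRing.Formula α :=
  (Formula.iExs (Fin (N + 1) × Fin n)
      ((Formula.iInf fun i : Fin (N + 1) => φ.relabel (Sum.map _root_.id fun l => (i, l))) ⊓
        Formula.iInf fun ij : {ij : Fin (N + 1) × Fin (N + 1) // ij.1 ≠ ij.2} =>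
          Formula.iSup fun l : Fin n =>
            (ExpFormula.eq (var (Sum.inr (ij.1.1, l))) (var (Sum.inr (ij.1.2, l)))).not)).not

/-- **"There are exactly `r` tuples `x̄` with `φ(v̄, x̄)`"**. [folklore] -/
def exactCardF (φ : Language.orderedExpRing.Formula (α ⊕ Fin n)) : ℕ →
    Language.orderedExpRing.Formula α
  | 0 => atMostF φ 0
  | r + 1 => atMostF φ (r + 1) ⊓ (atMostF φ r).not

variable {M : Type*} [Language.orderedExpRing.Structure M] [Field M] [LinearOrder M]
  [LawfulStructure M]

omit [Field M] [LawfulStructure M] in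
/-- Realization of `atMostF`: the solution set has at most `N` elements. [folklore] -/
theorem realize_atMostF (φ : Language.orderedExpRing.Formula (α ⊕ Fin n)) (N : ℕ) (v : α → M) :
    (atMostF φ N).Realize v ↔ {x : Fin n → M | φ.Realize (Sum.elim v x)}.encard ≤ N := by
  rw [encard_le_coe_iff_forall_not_injective]
  simp only [atMostF, Formula.realize_not, Formula.realize_iExs, Formula.realize_inf,
    Formula.realize_iInf, Formula.realize_iSup, Formula.realize_relabel, ExpFormula.realize_eq,
    Term.realize_var, Sum.elim_inr, not_exists, not_and, Sum.elim_comp_map, Function.comp_id,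
    Set.mem_setOf_eq]
  constructor
  · intro h f hf hinj
    refine h (fun il => f il.1 il.2) (fun i => hf i) ?_
    rintro ⟨⟨i, j⟩, hij⟩
    by_contra hall
    push Not at hall
    exact hij (hinj (funext hall))
  · intro h w hw hdist
    refine h (fun i l => w (i, l)) (fun i => hw i) fun i j hij => ?_
    by_contra hne
    obtain ⟨l, hl⟩ := hdist ⟨(i, j), hne⟩
    exact hl (congrFun hij l)

omit [Field M] [LawfulStructure M] in
/-- Realization of `exactCardF`: the solution set has exactly `r` elements. [folklore] -/
theorem realize_exactCardF (φ : Language.orderedExpRing.Formula (α ⊕ Fin n)) (r : ℕ) (v : α → M) :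
    (exactCardF φ r).Realize v ↔ {x : Fin n → M | φ.Realize (Sum.elim v x)}.encard = r := by
  cases r with
  | zero =>
    rw [exactCardF, realize_atMostF]
    simp
  | succ r =>
    rw [exactCardF, Formula.realize_inf, Formula.realize_not, realize_atMostF, realize_atMostF,
      not_le]
    constructor
    · rintro ⟨h1, h2⟩
      refine le_antisymm h1 ?_
      rw [Nat.cast_add_one]
      exact Order.add_one_le_of_lt h2
    · intro h
      rw [h]
      exact ⟨le_rfl, by exact_mod_cast Nat.lt_succ_self r⟩

end Count

/-! ### The real non-singular zero set and Wilkie's Proposition (Khovanskii) -/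

section Proposition

variable {m n p : ℕ}

/-- The non-singular zero set `Vⁿˢ(f₁(β̄, ·), …, fₚ(β̄, ·)) ⊆ ℝⁿ` of terms `fᵣ(ȳ, x̄)` at the
parameter point `β̄ ∈ ℝᵐ`: common zeros at which the gradient rows are linearly independent
(Wilkie 1989, §3 p. 390 and §5 p. 402, the case `K = ℝ`). [cite: Wilkie1989, §5, Proposition, p. 402] -/
def realNonsingularZeroSet (f : Fin p → Language.orderedExpRing.Term (Fin m ⊕ Fin n))
    (β : Fin m → ℝ) : Set (Fin n → ℝ) :=
  {x | (∀ r, (f r).realize (Sum.elim β x) = 0) ∧ LinearIndependent ℝ (fun r => grad (f r) β x)}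

/-- Membership in the real non-singular zero set. [folklore] -/
theorem mem_realNonsingularZeroSet {f : Fin p → Language.orderedExpRing.Term (Fin m ⊕ Fin n)}
    {β : Fin m → ℝ} {x : Fin n → ℝ} :
    x ∈ realNonsingularZeroSet f β ↔
      (∀ r, (f r).realize (Sum.elim β x) = 0) ∧ LinearIndependent ℝ (fun r => grad (f r) β x) :=
  Iff.rfl

/-- **Wilkie 1989, §5, Proposition (Khovanskii's finiteness theorem; named fact).**  "Let
`m, n ∈ ℕ`, `n ≥ 2`, `ȳ = (y₁, …, yₘ)`, `x̄ = (x₁, …, xₙ)`, and suppose `f₁(ȳ, x̄), …, fₚ(ȳ, x̄)`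
are terms of `L`. Then there is `N ∈ ℕ` such that for any `β̄ ∈ ℝᵐ` the subset
`Vⁿˢ(f₁(β̄, ·), …, fₚ(β̄, ·))` of `ℝⁿ` has at most `N` connected components", attributed to
A. G. Khovanskii, *Fewnomials and Pfaff manifolds* (Proc. ICM 1983).  Here "has at most `N`
connected components" is rendered as: the set of connected components
`{connectedComponentIn Vⁿˢ x : x ∈ Vⁿˢ}` has extended cardinality `≤ N` (in particular it is
finite).  The parenthetical consequence "(and hence at most `N` points if `p = n`)" is proved
below (`Wilkie1989_khovanskiiProposition.exists_encard_le`). [cite: Wilkie1989, §5, Proposition, p. 402] [cite: Khovanskii1984, Theorem on Pfaff manifolds] -/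
def _root_.Literature.ModelTheory.ExponentialFields.Wilkie1989_khovanskiiProposition : Prop :=
  ∀ (m n p : ℕ) (f : Fin p → Language.orderedExpRing.Term (Fin m ⊕ Fin n)), 2 ≤ n →
    ∃ N : ℕ, ∀ β : Fin m → ℝ,
      (Set.range fun x : realNonsingularZeroSet f β =>
        connectedComponentIn (realNonsingularZeroSet f β) (x : Fin n → ℝ)).encard ≤ N

/-! ### Non-singular zeros of a square system are isolated -/

/-- **Isolation of non-singular zeros** (inverse function theorem): a point of the non-singular
zero set of a square system of terms has a neighbourhood containing no other common zero.
[folklore] -/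
theorem exists_nhds_inter_subset_singleton (f : Fin n → Language.orderedExpRing.Term (Fin m ⊕ Fin n))
    (β : Fin m → ℝ) {x : Fin n → ℝ} (hx : x ∈ realNonsingularZeroSet f β) :
    ∃ U ∈ 𝓝 x, U ∩ {y | ∀ r, (f r).realize (Sum.elim β y) = 0} ⊆ {x} := by
  -- the derivative of the system function at `x` is an isomorphism
  set L := fderiv ℝ (sysFun f β) x with hL
  have hrange : L.range = ⊤ := range_fderiv_sysFun_eq_top f β x hx.2
  have hker : L.ker = ⊥ :=
    (LinearMap.ker_eq_bot_iff_range_eq_top_of_finrank_eq_finrank rfl).2 hrange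
  set e : (Fin n → ℝ) ≃L[ℝ] (Fin n → ℝ) := ContinuousLinearEquiv.ofBijective L hker hrange with he
  have hstrict : HasStrictFDerivAt (sysFun f β) (e : (Fin n → ℝ) →L[ℝ] (Fin n → ℝ)) x := by
    rw [he, ContinuousLinearEquiv.coe_ofBijective]
    exact (contDiff_sysFun f β (m := 1)).contDiffAt.hasStrictFDerivAt (by simp)
  have hinv := hstrict.eventually_left_inverse
  refine ⟨{y | hstrict.localInverse (sysFun f β) e x (sysFun f β y) = y}, hinv, ?_⟩
  rintro y ⟨hy, hy0⟩
  have hx0 : sysFun f β x = 0 := funext fun r => hx.1 r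
  have hy0' : sysFun f β y = 0 := funext fun r => hy0 r
  have hxx : hstrict.localInverse (sysFun f β) e x (sysFun f β x) = x := hinv.self_of_nhds
  change hstrict.localInverse (sysFun f β) e x (sysFun f β y) = y at hy
  rw [hy0', ← hx0, hxx] at hy
  exact hy.symm

/-- Hence the connected components of the non-singular zero set of a square system are points.
[folklore] -/
theorem connectedComponentIn_realNonsingularZeroSet_eq_singleton
    (f : Fin n → Language.orderedExpRing.Term (Fin m ⊕ Fin n)) (β : Fin m → ℝ) {x : Fin n → ℝ}
    (hx : x ∈ realNonsingularZeroSet f β) :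
    connectedComponentIn (realNonsingularZeroSet f β) x = {x} := by
  set V := realNonsingularZeroSet f β with hV
  obtain ⟨U, hU, hUsub⟩ := exists_nhds_inter_subset_singleton f β hx
  -- `{x}` is clopen in the subtype `V`
  have hopen : IsOpen ({⟨x, hx⟩} : Set V) := by
    rw [isOpen_iff_mem_nhds]
    rintro y (rfl : y = ⟨x, hx⟩)
    rw [mem_nhds_subtype]
    refine ⟨U, hU, fun z hz => ?_⟩
    have : (z : Fin n → ℝ) ∈ ({x} : Set (Fin n → ℝ)) := hUsub ⟨hz, z.2.1⟩
    exact Subtype.ext this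
  have hclopen : IsClopen ({⟨x, hx⟩} : Set V) := ⟨isClosed_singleton, hopen⟩
  have hsub := hclopen.connectedComponent_subset (mem_singleton _)
  apply Subset.antisymm
  · rw [connectedComponentIn_eq_image hx]
    rintro _ ⟨y, hy, rfl⟩
    have : y = ⟨x, hx⟩ := hsub hy
    rw [this]
    exact mem_singleton x
  · rw [singleton_subset_iff]
    exact mem_connectedComponentIn hx

/-- **"(and hence at most `N` points if `p = n`)"** (p. 402), proved from the Proposition: the
non-singular zero set of a square system of terms has at most `N` points, uniformly in the
parameters. [cite: Wilkie1989, §5, Proposition, p. 402] -/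
theorem _root_.Literature.ModelTheory.ExponentialFields.Wilkie1989_khovanskiiProposition.exists_encard_le
    (H : Wilkie1989_khovanskiiProposition) (m n : ℕ) (hn : 2 ≤ n)
    (f : Fin n → Language.orderedExpRing.Term (Fin m ⊕ Fin n)) :
    ∃ N : ℕ, ∀ β : Fin m → ℝ, (realNonsingularZeroSet f β).encard ≤ N := by
  obtain ⟨N, hN⟩ := H m n n f hn
  refine ⟨N, fun β => ?_⟩
  have heq : (Set.range fun x : realNonsingularZeroSet f β =>
      connectedComponentIn (realNonsingularZeroSet f β) (x : Fin n → ℝ)) =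
        (fun x : Fin n → ℝ => ({x} : Set (Fin n → ℝ))) '' realNonsingularZeroSet f β := by
    ext C
    constructor
    · rintro ⟨x, rfl⟩
      exact ⟨x, x.2, (connectedComponentIn_realNonsingularZeroSet_eq_singleton f β x.2).symm⟩
    · rintro ⟨x, hx, rfl⟩
      exact ⟨⟨x, hx⟩, connectedComponentIn_realNonsingularZeroSet_eq_singleton f β hx⟩
  have := hN β
  rwa [heq, Set.singleton_injective.encard_image] at this

/-! ### Transfer of the bound on points to the models of `T_exp` -/

/-- The first-order formula "`x̄ ∈ Vⁿˢ(f₁(ȳ, ·), …, fₙ(ȳ, ·))`" for a square system: all `fᵣ`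
vanish and the Jacobian determinant does not. [folklore] -/
def vnsFormula (f : Fin n → Language.orderedExpRing.Term (Fin m ⊕ Fin n)) :
    Language.orderedExpRing.Formula (Fin m ⊕ Fin n) :=
  (Formula.iInf fun r => ExpFormula.eq (f r) 0) ⊓ (ExpFormula.eq (minorTerm f _root_.id) 0).not

/-- Realization of `vnsFormula` in a lawful structure. [folklore] -/
theorem realize_vnsFormula {M : Type*} [Language.orderedExpRing.Structure M] [Field M]
    [LinearOrder M] [LawfulStructure M] (f : Fin n → Language.orderedExpRing.Term (Fin m ⊕ Fin n))
    (β : Fin m → M) (x : Fin n → M) :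
    (vnsFormula f).Realize (Sum.elim β x) ↔
      (∀ r, (f r).realize (Sum.elim β x) = 0) ∧ (Matrix.of fun r => grad (f r) β x).det ≠ 0 := by
  simp only [vnsFormula, Formula.realize_inf, Formula.realize_iInf, Formula.realize_not,
    ExpFormula.realize_eq, ExpTerm.realize_zero, realize_minorTerm, Matrix.submatrix_id_id, ne_eq]

/-- Over a field, a square matrix has independent rows iff its determinant is nonzero.
[folklore] -/
theorem linearIndependent_rows_iff_det_ne_zero {F : Type*} [Field F] (A : Matrix (Fin n) (Fin n) F) :
    LinearIndependent F (fun r => A r) ↔ A.det ≠ 0 := by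
  rw [show (fun r => A r) = A.row from rfl, Matrix.linearIndependent_rows_iff_isUnit,
    Matrix.isUnit_iff_isUnit_det, isUnit_iff_ne_zero]

/-- In `ℝ`, `vnsFormula` defines the real non-singular zero set. [folklore] -/
theorem setOf_realize_vnsFormula_real (f : Fin n → Language.orderedExpRing.Term (Fin m ⊕ Fin n))
    (β : Fin m → ℝ) :
    {x : Fin n → ℝ | (vnsFormula f).Realize (Sum.elim β x)} = realNonsingularZeroSet f β := by
  ext x
  rw [Set.mem_setOf_eq, realize_vnsFormula, mem_realNonsingularZeroSet,
    linearIndependent_rows_iff_det_ne_zero]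
  rfl

/-- In a model `K` of `T_exp`, `vnsFormula` defines the non-singular zero set
`RealExpModel.nonsingularZeroSet`. [folklore] -/
theorem setOf_realize_vnsFormula (K : Language.Theory.ModelType.{0, 0, 0} realExpTheory)
    (f : Fin n → Language.orderedExpRing.Term (Fin m ⊕ Fin n)) (a : Fin m → K) :
    {x : Fin n → K | (vnsFormula f).Realize (Sum.elim a x)} = nonsingularZeroSet f a := by
  ext x
  rw [Set.mem_setOf_eq, realize_vnsFormula, mem_nonsingularZeroSet, mem_zeroSet,
    linearIndependent_rows_iff_det_ne_zero]
  rfl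

/-- **The bound on points, in every model of `T_exp` (proved from the Proposition by transfer).**
For a square system of terms `f₁(ȳ, x̄), …, fₙ(ȳ, x̄)` (`n ≥ 2`) there is `N` such that in every
model `K ⊨ T_exp` and for all parameters `ā ∈ Kᵐ`, `Vⁿˢ(f₁(ā, ·), …, fₙ(ā, ·)) ⊆ Kⁿ` has at most
`N` points ("It thus follows that Lemmas 4 and 6 can be expressed as first-order sentences …",
p. 403; used on p. 406). [cite: Wilkie1989, §5, p. 403] -/
theorem _root_.Literature.ModelTheory.ExponentialFields.Wilkie1989_khovanskiiProposition.exists_encard_nonsingularZeroSet_le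
    (H : Wilkie1989_khovanskiiProposition) (m n : ℕ) (hn : 2 ≤ n)
    (f : Fin n → Language.orderedExpRing.Term (Fin m ⊕ Fin n)) :
    ∃ N : ℕ, ∀ (K : Language.Theory.ModelType.{0, 0, 0} realExpTheory) (a : Fin m → K),
      (nonsingularZeroSet f a).encard ≤ N := by
  obtain ⟨N, hN⟩ := H.exists_encard_le m n hn f
  refine ⟨N, fun K a => ?_⟩
  have hreal : ∀ v : Fin m → ℝ, (atMostF (vnsFormula f) N).Realize v := by
    intro β
    rw [realize_atMostF, setOf_realize_vnsFormula_real]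
    exact hN β
  have h := realize_formula_of_real K (atMostF (vnsFormula f) N) hreal a
  rwa [realize_atMostF, setOf_realize_vnsFormula] at h

end Proposition

end RealExpModel

end Literature.ModelTheory.ExponentialFields
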